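import Summits.CriticalPhenomena.SAWScalingLimit.Theses.SAWExpCovariance
import Literature.Probability.RandomPlanarGeometry.SAWScalingLimitFamily

/-!
# Line `birth` — registered skeleton for the crux `LimitAxioms` (stmt-CriticalPhenomena-6757)

Crux (FIXED; rank 5 of `route-CriticalPhenomena-SAWExpCovariance`, decl
`Summit.CriticalPhenomena.SAWScalingLimit.Theses.SAWExpCovariance.LimitAxioms`): every chordal family `P`
that is the FULL scaling limit `(lim)` of the critical `δℤ²` SAW laws — for every Dobrushin domain and EVERY
endpoint approximation — satisfies the three axioms the route's density/identification steps consume: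

  `P.IsRestriction ∧ (∀ D (r > 0) (w : ℂ), P (r·D + w) = (r · + w)_* (P D)) ∧ (a.s. simple, meeting ∂D only at a, b)`.

The hypothesis `P.IsChordal ∧ (lim)` is, literally, `SAW.IsScalingLimitFamily P`
(`Literature/…/SAWScalingLimitFamily.lean`; `isScalingLimitFamily_iff` is `Iff.rfl`), and the three conjuncts
are, literally, `P.IsRestriction` (`ChordalCurveFamily.lean`), the real-similarity clause and the simplicity
clause of the crux. The crux is the sub-bundle "restriction + real similarities + simplicity" of the sibling
crux `AxiomsOfLimit` (stmt-CriticalPhenomena-1370, route SAWRestrictionRigidity; no Markov kernel, no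
reversal, no quarter-turns / conjugation here), so this skeleton is CUT COMPATIBLY with the registered line
`Cruxes/AxiomsOfLimit/Lines/birth.lean`: the stubs `stub_simplePassage` and `stub_restrictionPassage` below are
character-for-character the sibling's stubs of the same names (one `Theorems/…` proof closes the stub on both
crux items), and `stub_realSimilarityPassage` is the `r·i⁰` case of the sibling's `stub_latticeSymmetryPassage`
(two lines from it by `ChordalFamily.IsLatticeSimilarityCovariant.dilation_eq`). Every stub is stated over
TREE VOCABULARY ONLY and lands verbatim as a
`Theorems/SAWExpCovarianceLimitAxioms<Stub>.lean --supports stmt-CriticalPhenomena-6757`.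

## The cut (grounder g27-18 / refuter rreview-6e240eb2 read-back of 2026-08-15: "THREE CONJUNCTS, graded
## separately — (2) provable now, (1) and (3) open and sharing one missing input"), threaded so that the
## restriction passage may consume the simplicity / boundary-avoidance estimate

* S1 `stub_realSimilarityPassage` — EXACT LATTICE DILATIONS AND TRANSLATIONS PASS TO THE FULL LIMIT:
  `SAW.IsScalingLimitFamily P → ∀ D (r : ℝ) (hr : 0 < r) (w : ℂ), P (D.map (similarity r _ w)) = (P D).map (…)`.
  Dilations are exact through the mesh change `(r·Ω)_δ = r·Ω_{δ/r}` (same lattice sites, `δ/r → 0⁺` is again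
  the full filter, endpoint approximations transport as `δ ↦ a (δ/r)`); a translation by an axis-parallel `w`
  is a lattice vector along `δ_n = |w|/n`, so one SPLICES the translated endpoints into an arbitrary endpoint
  approximation of `D + w` (cf. `isEndpointApprox_splice`, `Cruxes/EventualTight/Disproof.lean`), restricts the
  full-filter limit `(lim)` to that sequence, and composes `w = (w₁, 0) + (0, w₂)` and the dilation
  (`ChordalFamily.covariant_trans`, `MarkedDomain.map_map`); throughout only uniqueness of limits in law is
  used (`TendstoLaw` tested on bounded continuous functions; `SAW.IsScalingLimitFamily.unique / apply_eq /
  apply_eq_of_carrier_eq`, `SAW.exists_isEndpointApprox`, `IsEndpointApprox.congr`). Size M–L (lattice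
  transport API for `DomainSAW / weight / law / curve` under `z ↦ r z` and `z ↦ z + δ k`, splice, uniqueness
  along a sequence). PROVABLE NOW, unconditionally (every identity is exact at the lattice level).
* S2 `stub_simplePassage` (HARDEST) — THE LIMIT IS CARRIED BY SIMPLE CURVES MEETING ∂D ONLY AT a, b:
  `SAW.IsScalingLimitFamily P → ∀ D, ∀ᵐ γ ∂(P D), γ ∈ CurveClass.simple ∧ γ.range ∩ frontier D ⊆ {a, b}`.
  `CurveClass.simple` is not (sequentially) closed (`simple_not_isClosed`, `exists_weakLimit_not_ae_simple` in
  `Cruxes/SimpleSubseqLimits/Disproof.lean` §4: "the soft road is closed"), so this is a genuine uniform lattice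
  estimate: no macroscopic near-self-touching and no boundary crawling of the `x_c`-SAW under EVERY endpoint
  approximation (LSW04 §3.4.5 heuristic; Kennedy–Lawler 2013 boundary effects; only sub-ballisticity,
  Duminil-Copin–Hammond 2013, is in print; believed via SLE_{8/3}, κ ≤ 4). Same statement as the sibling's
  `stub_simplePassage` and as the open item `SAWConfRestriction.SimpleOfLimit` (stmt-CriticalPhenomena-0774) with
  the hypothesis bundled; WEAKER than the subsequential-limit crux `SimpleSubseqLimits` (stmt-4982), whose
  Disproof §3 shows that already `¬SimpleSubseqLimits → ¬SAWScalingLimit`. Size L–XL.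
* S3 `stub_restrictionPassage` — RESTRICTION PASSES TO THE LIMIT, GIVEN S2's conclusion (for ALL domains):
  `SAW.IsScalingLimitFamily P → (simple ∧ boundary-avoiding a.s., every D) → P.IsRestriction`.
  Lattice level: `P_δ^{D'}(T) · P_δ^{D}(γ ⊆ D'_δ) = P_δ^{D}(T ∩ {γ ⊆ D'_δ})` is an identity for the same
  endpoints (LSW04 §3.4.5: same walks, same weights `x_c^{|γ|}`). The content is the passage: the event
  `{range ⊆ closure D'}` is closed (`CurveClass.isClosed_rangeSubset`; limsup side by portmanteau) but has
  EMPTY interior (every curve starts at `a ∈ ∂D'`), so the liminf side is run relative to the chordal curves of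
  `D̄`: its relative boundary is "crawls on `∂D ∩ ∂D'` away from `a, b`" (null by the hypothesis at `D`) or
  "touches `∂D' ∩ D` without crossing" — null because, by the exact lattice factorisation,
  `P_δ^{D}(γ ⊆ D'_δ, γ within ε of ∂D' ∩ D) ≤ P_δ^{D'}(γ within ε of ∂D' ∩ D)`, whose limit is killed as
  `ε → 0` by the hypothesis at `D'`; sub-domains pinched at `a` or `b` carry a `P D`-null event and a vacuous
  product identity. Plus largest-component bookkeeping `D'_δ ⊆ D_δ` eventually on compacts
  (`MeshDomainJordan.lean`; refuter notes on stmt-0773). Character-for-character the sibling's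
  `stub_restrictionPassage`; weaker than the open item `SAWConfRestriction.RestrictionOfLimit` (stmt-0773).
  Size L; plausibly provable WITHOUT new estimates once S2 is in hand (all estimate content sits in S2).

`LimitAxioms_of` (kernel-checked, no `sorry` of its own) bundles the crux hypotheses into
`SAW.IsScalingLimitFamily P`, runs S2, feeds it to S3, and reassembles the three conjuncts with S1; its
hypotheses are the three stubs under their registered names (`__Registered.stub_…`, see below) and its
conclusion is the route decl `Summit.CriticalPhenomena.SAWScalingLimit.Theses.SAWExpCovariance.LimitAxioms` BY NAME.

Every stub is a CONSEQUENCE of the crux (S1, S2 are conjuncts; S3's conclusion is a conjunct and its extra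
hypothesis only weakens it), so the cut loses nothing: the three stubs hold iff the crux holds. Disproof used:
none relevant — no `Disproof.lean` / `_false_without_` theorem / `Negative/` lemma exists for this crux
(`ledger crux ls stmt-CriticalPhenomena-6757`: no workfiles; `ledger workitem stubs`: none, 2026-08-17); the
sibling Disproofs honoured: `SimpleSubseqLimits/Disproof.lean` §2 (both endpoint-limit fields of
`IsEndpointApprox` are load-bearing for simplicity — S2 keeps the full `IsEndpointApprox` inside
`IsScalingLimitFamily`), §4 (no soft simplicity — S2 is declared the estimate, not hidden in S3), §9
(criticality is load-bearing — every stub is about `SAW.law`, the `x_c` law). Negatives index 2026-08-17: 11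
entries, none a passage-to-the-limit statement; the refuted all-δ tightness stmt-0772 is not used (no stub
quantifies over all meshes). Inputs already PROVED in the tree, to be used, not re-stubbed:
`SAW.exists_isEndpointApprox`, `SAW.IsScalingLimitFamily.unique / apply_eq_of_carrier_eq` (= the route's
closed support item `CarrierDependence`), `IsEndpointApprox.congr`, `ChordalFamily.covariant_trans`,
`CurveClass.isClosed_rangeSubset / measurableSet_rangeSubset`, `CurveClass.measurableSet_simple_holds`.
-/

noncomputable section

open MeasureTheory Filter Topology Set
open Literature.Probability.RandomPlanarGeometry Literature.Probability.LatticeModels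

namespace Summit.CriticalPhenomena.SAWScalingLimit.Cruxes.LimitAxioms.Birth

/-! ### Vocabulary of the line: the three passages as named statements -/

/-- The simplicity / boundary-avoidance clause of the crux for one family `P` (conjunct (iii)): every `P D`
is carried by simple curves meeting `∂D` only at the two marked points. -/
def SimpleBoundaryAvoiding (P : ChordalFamily) : Prop :=
  ∀ D : DobrushinDomain, ∀ᵐ γ ∂(P D),
    γ ∈ CurveClass.simple ∧ γ.range ∩ frontier D.carrier ⊆ {D.pt 0, D.pt 1}

/-- **S1, named.** Exact lattice dilations and translations (`z ↦ r z + w`, `r > 0`, `w ∈ ℂ`) pass to every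
full scaling-limit family — conjunct (ii) of the crux, with its binder shape. -/
def RealSimilarityPassage : Prop :=
  ∀ P : ChordalFamily, SAW.IsScalingLimitFamily P →
    ∀ (D : DobrushinDomain) (r : ℝ) (hr : 0 < r) (w : ℂ),
      P (D.map (similarity (r : ℂ) (Complex.ofReal_ne_zero.mpr hr.ne') w)) =
        (P D).map (CurveClass.map
          (similarity (r : ℂ) (Complex.ofReal_ne_zero.mpr hr.ne') w : C(ℂ, ℂ)))

/-- **S2, named.** Every full scaling-limit family is carried by simple, boundary-avoiding curves. -/
def SimplePassage : Prop :=
  ∀ P : ChordalFamily, SAW.IsScalingLimitFamily P → SimpleBoundaryAvoiding P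

/-- **S3, named.** Restriction passes to every simple, boundary-avoiding full scaling-limit family. -/
def RestrictionPassage : Prop :=
  ∀ P : ChordalFamily, SAW.IsScalingLimitFamily P → SimpleBoundaryAvoiding P → P.IsRestriction

/-! ### The stubs (the ONLY `sorry`s of this file)

Each stub is stated over TREE VOCABULARY ONLY (the named statements above unfolded by hand), so that it lands
verbatim as a `Theorems/…` file `--supports stmt-CriticalPhenomena-6757` without importing this workfile; the
`*_holds` theorems below certify definitionally that the unfolded text IS the named statement. S2 and S3 are
character-for-character the stubs of the same names registered on the sibling crux stmt-CriticalPhenomena-1370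
(`Cruxes/AxiomsOfLimit/Lines/birth.lean`). -/

/-- **S1 — exact lattice dilations and translations pass to the full limit.** A full scaling-limit family of
the critical `δℤ²` SAW is covariant under `z ↦ r z + w` (`r > 0`, `w ∈ ℂ`): dilations are exact through
`(r·Ω)_δ = r·Ω_{δ/r}` (endpoint approximations transport as `δ ↦ a (δ/r)`); translations by an axis-parallel
`w` are exact along `δ_n = |w|/n` (splice the translated endpoints into any approximation of `D + w`, restrict
the full-filter limit to the sequence, compose the two axis directions and the dilation); throughout, limits
in law are unique and endpoint approximations exist for every Dobrushin domain (`SAW.exists_isEndpointApprox`).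
Provable now; the `r·i⁰` case of the sibling's `stub_latticeSymmetryPassage`. -/
theorem stub_realSimilarityPassage :
    ∀ P : ChordalFamily, SAW.IsScalingLimitFamily P →
      ∀ (D : DobrushinDomain) (r : ℝ) (hr : 0 < r) (w : ℂ),
        P (D.map (similarity (r : ℂ) (Complex.ofReal_ne_zero.mpr hr.ne') w)) =
          (P D).map (CurveClass.map
            (similarity (r : ℂ) (Complex.ofReal_ne_zero.mpr hr.ne') w : C(ℂ, ℂ))) := by
  sorry

/-- **S2 (hardest) — the limit is carried by simple curves meeting `∂D` only at the marked points.** A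
genuine uniform lattice estimate (no macroscopic near-self-touching, no boundary crawling of the critical SAW
under every endpoint approximation); `CurveClass.simple` is not a closed event, so nothing soft gives it
(`Cruxes/SimpleSubseqLimits/Disproof.lean` §4). Same statement as the sibling's `stub_simplePassage` and as
`SAWConfRestriction.SimpleOfLimit` with the hypothesis bundled. -/
theorem stub_simplePassage :
    ∀ P : ChordalFamily, SAW.IsScalingLimitFamily P →
      ∀ D : DobrushinDomain, ∀ᵐ γ ∂(P D),
        γ ∈ CurveClass.simple ∧ γ.range ∩ frontier D.carrier ⊆ {D.pt 0, D.pt 1} := by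
  sorry

/-- **S3 — restriction passes to the limit, given simplicity and boundary avoidance in every domain.** The
lattice restriction identity (LSW04 §3.4.5) is exact for equal endpoints; the passage runs portmanteau
relative to the chordal curves of `D̄` on the closed event `{range ⊆ closure D'}`, whose relative boundary is
null by "no crawling on `∂D ∩ ∂D'`" (the hypothesis at `D`) and "no touching of `∂D' ∩ D` without crossing"
(exact lattice factorisation through `P_δ^{D'}` + the hypothesis at `D'`); sub-domains pinched at `a` or `b`
are `P D`-null, where the product identity is vacuous; largest-component bookkeeping `D'_δ ⊆ D_δ` on compacts.
Same statement as the sibling's `stub_restrictionPassage`. -/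
theorem stub_restrictionPassage :
    ∀ P : ChordalFamily, SAW.IsScalingLimitFamily P →
      (∀ D : DobrushinDomain, ∀ᵐ γ ∂(P D),
        γ ∈ CurveClass.simple ∧ γ.range ∩ frontier D.carrier ⊆ {D.pt 0, D.pt 1}) →
      P.IsRestriction := by
  sorry

/-! ### Consistency: each named statement IS its registered stub (definitionally) -/

theorem realSimilarityPassage_holds : RealSimilarityPassage := stub_realSimilarityPassage
theorem simplePassage_holds : SimplePassage := stub_simplePassage
theorem restrictionPassage_holds : RestrictionPassage := stub_restrictionPassage

/-! ### Name-keyed aliases of the three statements — the hypotheses of `LimitAxioms_of`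

The native skeleton audit (`#h21_check_skeleton`) admits a hypothesis of the skeleton theorem only if its head
constant is a registered obligation or is NAMED like a declared stub; `__Registered.stub_X` is the statement of
`stub_X` under that name (device of `Cruxes/AxiomsOfLimit/Lines/birth.lean`: the `__` namespace is an
implementation detail, so the audit's stub report resolves each `stub_…` to the sorried theorem, not to the
alias; the gate-reserved `@[stub]` attribute is not written by a planner). Each alias is `rfl`-equal to its
statement. -/
namespace __Registered

/-- Alias of `RealSimilarityPassage` keyed by the registered stub name. -/
abbrev stub_realSimilarityPassage : Prop := RealSimilarityPassage
/-- Alias of `SimplePassage` keyed by the registered stub name. -/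
abbrev stub_simplePassage : Prop := SimplePassage
/-- Alias of `RestrictionPassage` keyed by the registered stub name. -/
abbrev stub_restrictionPassage : Prop := RestrictionPassage

end __Registered

/-! ### The skeleton theorem: the three stubs imply the crux, BY NAME -/

/-- **`LimitAxioms` from the line `birth`** (kernel-checked, no `sorry` of its own): bundle the crux's
hypotheses `P.IsChordal`, `(lim)` into `SAW.IsScalingLimitFamily P` (definitional), run S2 (simplicity and
boundary avoidance in every domain), feed it to S3 (restriction), and reassemble the three conjuncts with S1
(real similarities, whose binder shape is the crux's own). Hypotheses = the three stubs, under their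
registered names; conclusion = the route decl, by name. -/
theorem LimitAxioms_of (hSim : __Registered.stub_realSimilarityPassage)
    (hS : __Registered.stub_simplePassage) (hR : __Registered.stub_restrictionPassage) :
    Summit.CriticalPhenomena.SAWScalingLimit.Theses.SAWExpCovariance.LimitAxioms := by
  intro P hP hlim
  have hsl : SAW.IsScalingLimitFamily P := ⟨hP, hlim⟩
  have hs : SimpleBoundaryAvoiding P := hS P hsl
  exact ⟨hR P hsl hs, hSim P hsl, hs⟩

/-- Wiring check (an `example`, so that `LimitAxioms_of` stays the only theorem concluding the crux): the
registered stubs, with their tree-vocabulary types, feed the skeleton theorem as stated — this term becomes the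
crux proof when the three `sorry`s above are discharged. -/
example : Summit.CriticalPhenomena.SAWScalingLimit.Theses.SAWExpCovariance.LimitAxioms :=
  LimitAxioms_of stub_realSimilarityPassage stub_simplePassage stub_restrictionPassage

end Summit.CriticalPhenomena.SAWScalingLimit.Cruxes.LimitAxioms.Birth

end
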